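import Literature.NumberTheory.EllipticCurves.AnticyclotomicSignedTransferTheorem
import HarnessLib

/-!
# Stub S1 `stub_bdpLowerHalfRatSS` of line `bdpline` (crux `AnticyclotomicEisensteinDivisibility`,
# stmt-BirchSwinnertonDyer-20727) — the EISENSTEIN-direction transfer: Castella–Wan's proof of
# Thm. 6.8 ((6.12)–(6.16)) run for the OPPOSITE divisibility, PROVED on the tree's carriers

Width seat bsd-line-sbc-p1-w2 (gen 5), `--supports stmt-BirchSwinnertonDyer-20727`. The registered
research stub S1 asks, at a good supersingular `p ≥ 5`, for the RATIONAL Eisenstein half of the BDP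
anticyclotomic main conjecture, `p^k · ch_Λ(X_ac) · Λ^ur ⊆ (L_p^BDP)`, `X_ac = Castella2018.AcSelmer.XAc
(W⁄K) p κ₂ v̄ ∅ γ₂` (Castella–Wan's `X^{rel,str}`). Castella–Wan's Thm. 6.8 (Math. Ann. 389 (2024), MS
pp. 29–31) proves the EQUIVALENCE of that divisibility with the Eisenstein direction of the signed
Heegner point main conjecture (Conj. 4.8), `char_{Λac}(X^±_tors) ⊂ char_{Λac}(Sel_±(K, 𝐓^ac)/Λ^ac z^±_∞)²`
("The same result holds for the opposite divisibilities"). The Literature file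
`AnticyclotomicSignedTransferTheorem` PROVES "(i) with `⊇` ⟹ (ii) with `⊇`" as module algebra on the
tree's carriers from the typed inputs `AcSigned.TransferInputs`. THIS FILE proves the other direction,
"(i) with `⊆` up to `p^k` ⟹ (ii) with `⊆` up to `p^k`", the one S1 consumes — so that S1 (on the
sub-cell `p ∤ h_K` of the signed `Setting`) REDUCES to Heegner-point currency, where
Bertolini–Longo–Venerucci (Math. Ann. 2026, Thm. A, all-additive sub-cell) and Kolyvagin systems live.

## The printed argument and what the `⊆` direction needs in addition

Print (MS p. 31): (6.15) `char(X^{±,str}) = char(X^±_tors)·char(coker loc_𝔭)`; (6.16) `char(X^{rel,str}) =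
char(X^±_tors)·char(coker loc_𝔭)²`; (6.14) `char(Sel_±/Λz)·char(coker loc_𝔭)·Λ^ur = (𝓛^BDP_𝔭)`. In the
tree (6.15)–(6.16) is the PROVED EQUALITY `Module.isTorsion_and_charIdeal_eq_of_surjective_pair`:
`char(X^{rel,str}) = char(ker r)·char(ker r')·char(X_{ε,tors})` with `ker r' = coker(loc_𝔭 | Sel_ε) ≃
Λ/ι(I)`, `ker r = coker(loc_𝔭 | Sel^{ε,rel}) ≃ Λ/ι(I')`, `I ⊆ I'`. For `⊇` the inequality `char(ker r') ⊆
char(ker r)` suffices; for `⊆` the two cokernels must AGREE, i.e. print's sentence (MS p. 30)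
"`Sel_±(K, 𝐓^ac) = Sel_{±,rel}(K, 𝐓^ac)`, since the quotient `Sel_{±,rel}/Sel_±` injects into
`H¹(K_𝔭̄, 𝐓^ac)/H¹_±(K_𝔭̄, 𝐓^ac)`, which has trivial `Λ^ac`-torsion by Proposition 3.8" — NOT a field of
`TransferInputs`; it enters as the HYPOTHESIS `hEq` (every `loc_𝔭`-image of `Sel^{ε,rel}` is a
`loc_𝔭`-image of `Sel_ε`). Then `I' = I`, and the Eisenstein input `p^k·char(X_{ε,tors}) ⊆
ι(char(Sel_ε/Λz))²` (`ι`-twisted form, flag `dual-convention`) gives `p^k·char(X^{rel,str}) ⊆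
ι(char(Sel_ε/Λz))²·char(ker r')² = (ι Log loc_𝔭 z)²`, and along every compatible `j : ℤ_p → R₀` the
explicit reciprocity law `(L) = ι((Log loc_𝔭 z)²)·R₀⟦T⟧` gives `p^k·char(X^{rel,str})·R₀⟦T⟧ ⊆ (L)`.

## Contents (all PROVED, standard axioms; no definition, no named fact, no `sorry`)

* §1 `TransferInputs.span_pow_mul_charIdeal_le_span_sq` — THE TRANSFER; `…_map_le_span` — along `j`.
* §2 `TransferInputs.span_pow_mul_XAc_charIdeal_map_le_span` — the same on the crux's object
  `Castella2018.AcSelmer.XAc (W⁄K) p κ 𝔭' ∅ γ` (bridge `X.charIdeal_at_str_rel_eq_XAc_charIdeal`), the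
  Eisenstein input in the sibling currency `signedHeegnerCharIdeal`.
Nothing about elliptic curves is asserted unconditionally: the inputs are hypotheses. BSD / the crux
are not proved by this file.
-/
-- D-0017: single-problem summit, the namespace repeats the problem name by design.
set_option linter.dupNamespace false
set_option autoImplicit false

noncomputable section

open scoped Classical

open PowerSeries NumberField IsDedekindDomain Field
open Literature.NumberTheory.EllipticCurves Literature.NumberTheory.GaloisRepresentations
open Literature.NumberTheory.EllipticCurves.IwasawaDual
open Literature.NumberTheory.EllipticCurves.AcSigned

universe u

namespace Summit.BirchSwinnertonDyer.BirchSwinnertonDyer.Theorems.SignedBaseChangeAcDivEisensteinTransfer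

section Assembly

variable {K : Type u} [Field K] [NumberField K] {W : WeierstrassCurve K} {p : ℕ} [Fact p.Prime]
  {κ : ZpExtension K p} {γ : absoluteGaloisGroup K} {hγ : κ.IsTopGenerator γ}
  {𝔭 : HeightOneSpectrum (𝓞 K)} {h𝔭 : IsNonsplitIn κ 𝔭} {γ𝔭 : absoluteGaloisGroup (𝔭.adicCompletion K)}
  {hγ𝔭 : κ (resGalOfEmb (closureEmb (K := K) (𝔭.adicCompletion K)) γ𝔭) = κ γ}
  {𝔭' : HeightOneSpectrum (𝓞 K)} {h𝔭𝔭' : 𝔭 ≠ 𝔭'} {h𝔭p : ((p : ℕ) : 𝓞 K) ∈ 𝔭.asIdeal} {ε : ℤˣ}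
  {z : selmerLambdaAdic W p κ γ (fun _ ↦ .sgn ε)} {L : UnrSeries p}

/-! ## §1 The Eisenstein-direction transfer -/

set_option maxHeartbeats 4000000 in
set_option synthInstance.maxHeartbeats 200000 in
/-- **The transfer for the OPPOSITE divisibility (Castella–Wan, proof of Thm. 6.8, (i) with `⊆` ⟹
(ii) with `⊆`, up to a power of `p`), PROVED on the tree's carriers for every prime `p`.**
Hypotheses: `TransferInputs … ε z L`; `loc_𝔭` injective on `Sel_ε(K, 𝐓^ac)` ("`Sel^{str,ε} = 0`"); `X_ε` f.g. of rank
one; `hEq` = print's "`Sel_±(K, 𝐓^ac) = Sel_{±,rel}(K, 𝐓^ac)`" (MS p. 30, via Prop. 3.8) as "every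
`loc_𝔭`-image of `Sel^{ε,rel}` is a `loc_𝔭`-image of `Sel_ε`"; the EISENSTEIN INPUT up to `p^k`,
`(p^k)·char_Λ(X_{ε,tors}) ⊆ ι(char_Λ(Sel_ε/Λ z))²` (the `ι`-twisted form of print's
"`char(X^±_tors) ⊂ char(Sel_±(K, 𝐓^ac)/Λ^ac z^±_∞)²`", flag `dual-convention`). Conclusion: for every
signed logarithm, `(p^k)·char_Λ(X^{rel,str}) ⊆ ((ι Log loc_𝔭 z)²)`. Proof: the sibling file's §3–§5
verbatim up to the EQUALITY (6.15)–(6.16); `hEq` makes `I' = I`, so `char(ker r) = char(ker r')`.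
[cite: CastellaWan2023, Thm. 6.8 "the same result holds for the opposite divisibilities" and its proof, (6.12)–(6.16) (MS pp. 29–31)] -/
theorem TransferInputs.span_pow_mul_charIdeal_le_span_sq [W.IsElliptic]
    (h : TransferInputs W p κ γ hγ 𝔭 h𝔭 γ𝔭 hγ𝔭 𝔭' h𝔭𝔭' h𝔭p ε z L)
    (hinj : Function.Injective (locSignedAt W p κ 𝔭 h𝔭 γ γ𝔭 hγ𝔭 (fun _ ↦ .sgn ε) ε rfl h𝔭p))
    (hX : X.HasRank W p κ ∅ (fun _ ↦ .sgn ε) hγ 1)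
    (hEq : ∀ x' : selmerLambdaAdic W p κ γ (PCond.at 𝔭' .rel (.sgn ε)),
      ∃ x : selmerLambdaAdic W p κ γ (fun _ ↦ .sgn ε),
        locSignedAt W p κ 𝔭 h𝔭 γ γ𝔭 hγ𝔭 (fun _ ↦ .sgn ε) ε rfl h𝔭p x =
          locSignedAt W p κ 𝔭 h𝔭 γ γ𝔭 hγ𝔭 (PCond.at 𝔭' .rel (.sgn ε)) ε
            (PCond.at_of_ne .rel (.sgn ε) h𝔭𝔭') h𝔭p x')
    {k : ℕ}
    (hEis :
      letI := selmerLambdaAdic.moduleOfGen W p κ γ hγ (fun _ ↦ PCond.sgn ε)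
      Ideal.span {((p : ℕ) : IwasawaAlgebra p) ^ k} * X.torsionCharIdeal W p κ ∅ (fun _ ↦ .sgn ε) hγ ≤
        ((Module.charIdeal (IwasawaAlgebra p)
          (selmerLambdaAdic W p κ γ (fun _ ↦ .sgn ε) ⧸
            Submodule.span (IwasawaAlgebra p) {z})).map (IwasawaAlgebra.invol p)) ^ 2) :
    ∀ (Log : localSignedLambdaAdic (W.baseChange (𝔭.adicCompletion K)) p (localizeAt κ 𝔭 h𝔭) γ𝔭 ε →+
        IwasawaAlgebra p), IsSignedLog W p κ γ hγ 𝔭 h𝔭 γ𝔭 hγ𝔭 ε Log →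
      Ideal.span {((p : ℕ) : IwasawaAlgebra p) ^ k} * X.charIdeal W p κ ∅ (PCond.at 𝔭' .str .rel) hγ ≤
        Ideal.span
          {IwasawaAlgebra.invol p (Log (locSignedAt W p κ 𝔭 h𝔭 γ γ𝔭 hγ𝔭 (fun _ ↦ .sgn ε) ε rfl h𝔭p z)) ^ 2} := by
  intro Log hLog
  -- the carriers and their module structures
  letI iS : Module (IwasawaAlgebra p) (selmerLambdaAdic W p κ γ (fun _ ↦ .sgn ε)) :=
    selmerLambdaAdic.moduleOfGen W p κ γ hγ (fun _ ↦ PCond.sgn ε)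
  letI iS' : Module (IwasawaAlgebra p) (selmerLambdaAdic W p κ γ (PCond.at 𝔭' .rel (.sgn ε))) :=
    selmerLambdaAdic.moduleOfGen W p κ γ hγ (PCond.at 𝔭' .rel (.sgn ε))
  letI iH : Module (IwasawaAlgebra p) (localSignedLambdaAdic (W.baseChange (𝔭.adicCompletion K)) p
      (localizeAt κ 𝔭 h𝔭) γ𝔭 ε) :=
    localSignedLambdaAdic.moduleOfGen (W.baseChange (𝔭.adicCompletion K)) p (localizeAt κ 𝔭 h𝔭)
      γ𝔭 (isTopGenerator_localize_of_apply_eq p κ _ h𝔭 hγ𝔭 hγ) ε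
  letI iXre : Module (IwasawaAlgebra p) (X W p κ ∅ (PCond.at 𝔭 .rel (.sgn ε))) :=
    X.moduleOfGen W p κ ∅ (PCond.at 𝔭 .rel (.sgn ε)) hγ
  letI iXe : Module (IwasawaAlgebra p) (X W p κ ∅ (fun _ ↦ .sgn ε)) :=
    X.moduleOfGen W p κ ∅ (fun _ ↦ .sgn ε) hγ
  letI iXrs : Module (IwasawaAlgebra p) (X W p κ ∅ (PCond.at 𝔭' .str .rel)) :=
    X.moduleOfGen W p κ ∅ (PCond.at 𝔭' .str .rel) hγ
  letI iXes : Module (IwasawaAlgebra p) (X W p κ ∅ (PCond.at 𝔭' .str (.sgn ε))) :=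
    X.moduleOfGen W p κ ∅ (PCond.at 𝔭' .str (.sgn ε)) hγ
  haveI : Module.Finite (IwasawaAlgebra p) (X W p κ ∅ (PCond.at 𝔭 .rel (.sgn ε))) :=
    X.module_finite_empty W p κ _ hγ
  haveI : Module.Finite (IwasawaAlgebra p) (X W p κ ∅ (fun _ ↦ .sgn ε)) :=
    X.module_finite_empty W p κ _ hγ
  haveI : Module.Finite (IwasawaAlgebra p) (X W p κ ∅ (PCond.at 𝔭' .str .rel)) :=
    X.module_finite_empty W p κ _ hγ
  haveI : Module.Finite (IwasawaAlgebra p) (X W p κ ∅ (PCond.at 𝔭' .str (.sgn ε))) :=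
    X.module_finite_empty W p κ _ hγ
  -- `Sel_ε ≤ Sel^{ε,rel}` and the two localisation maps agree on it
  have hle : selmerLambdaAdic W p κ γ (fun _ ↦ .sgn ε) ≤
      selmerLambdaAdic W p κ γ (PCond.at 𝔭' .rel (.sgn ε)) :=
    selmerLambdaAdic_sgn_le_at_rel W p κ γ 𝔭' ε
  have hloc'_incl : ∀ x : selmerLambdaAdic W p κ γ (fun _ ↦ .sgn ε),
      locSignedAt W p κ 𝔭 h𝔭 γ γ𝔭 hγ𝔭 (PCond.at 𝔭' .rel (.sgn ε)) ε (PCond.at_of_ne .rel (.sgn ε) h𝔭𝔭') h𝔭p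
          (AddSubgroup.inclusion hle x) =
        locSignedAt W p κ 𝔭 h𝔭 γ γ𝔭 hγ𝔭 (fun _ ↦ .sgn ε) ε rfl h𝔭p x := fun x ↦ Subtype.ext rfl
  -- `Λ`-linear packaging of `loc_𝔭` (on `Sel_ε`, `Sel^{ε,rel}`) and of `Log`
  have hloc_smul : ∀ (f : IwasawaAlgebra p) (x : selmerLambdaAdic W p κ γ (fun _ ↦ .sgn ε)),
      locSignedAt W p κ 𝔭 h𝔭 γ γ𝔭 hγ𝔭 (fun _ ↦ .sgn ε) ε rfl h𝔭p (f • x) =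
        f • locSignedAt W p κ 𝔭 h𝔭 γ γ𝔭 hγ𝔭 (fun _ ↦ .sgn ε) ε rfl h𝔭p x :=
    fun f x ↦ locSignedAt_smul W p κ 𝔭 h𝔭 hγ𝔭 hγ rfl h𝔭p f x
  have hloc'_smul : ∀ (f : IwasawaAlgebra p)
      (x : selmerLambdaAdic W p κ γ (PCond.at 𝔭' .rel (.sgn ε))),
      locSignedAt W p κ 𝔭 h𝔭 γ γ𝔭 hγ𝔭 (PCond.at 𝔭' .rel (.sgn ε)) ε
          (PCond.at_of_ne .rel (.sgn ε) h𝔭𝔭') h𝔭p (f • x) =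
        f • locSignedAt W p κ 𝔭 h𝔭 γ γ𝔭 hγ𝔭 (PCond.at 𝔭' .rel (.sgn ε)) ε
          (PCond.at_of_ne .rel (.sgn ε) h𝔭𝔭') h𝔭p x :=
    fun f x ↦ locSignedAt_smul W p κ 𝔭 h𝔭 hγ𝔭 hγ (PCond.at_of_ne .rel (.sgn ε) h𝔭𝔭') h𝔭p f x
  obtain ⟨Logₗ, hLogₗ⟩ : ∃ Logₗ : localSignedLambdaAdic (W.baseChange (𝔭.adicCompletion K)) p
      (localizeAt κ 𝔭 h𝔭) γ𝔭 ε →ₗ[IwasawaAlgebra p] IwasawaAlgebra p, ∀ y, Logₗ y = Log y :=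
    ⟨{ toFun := Log, map_add' := map_add Log, map_smul' := fun f y ↦ hLog.1 f y }, fun _ ↦ rfl⟩
  obtain ⟨locₗ, hlocₗ⟩ : ∃ locₗ : selmerLambdaAdic W p κ γ (fun _ ↦ .sgn ε) →ₗ[IwasawaAlgebra p]
      localSignedLambdaAdic (W.baseChange (𝔭.adicCompletion K)) p (localizeAt κ 𝔭 h𝔭) γ𝔭 ε,
      ∀ x, locₗ x = locSignedAt W p κ 𝔭 h𝔭 γ γ𝔭 hγ𝔭 (fun _ ↦ .sgn ε) ε rfl h𝔭p x :=
    ⟨{ toFun := fun x ↦ locSignedAt W p κ 𝔭 h𝔭 γ γ𝔭 hγ𝔭 (fun _ ↦ .sgn ε) ε rfl h𝔭p x,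
       map_add' := map_add _, map_smul' := fun f x ↦ hloc_smul f x }, fun _ ↦ rfl⟩
  obtain ⟨loc'ₗ, hloc'ₗ⟩ : ∃ loc'ₗ : selmerLambdaAdic W p κ γ (PCond.at 𝔭' .rel (.sgn ε))
      →ₗ[IwasawaAlgebra p]
      localSignedLambdaAdic (W.baseChange (𝔭.adicCompletion K)) p (localizeAt κ 𝔭 h𝔭) γ𝔭 ε,
      ∀ x, loc'ₗ x = locSignedAt W p κ 𝔭 h𝔭 γ γ𝔭 hγ𝔭 (PCond.at 𝔭' .rel (.sgn ε)) ε
        (PCond.at_of_ne .rel (.sgn ε) h𝔭𝔭') h𝔭p x :=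
    ⟨{ toFun := fun x ↦ locSignedAt W p κ 𝔭 h𝔭 γ γ𝔭 hγ𝔭 (PCond.at 𝔭' .rel (.sgn ε)) ε
          (PCond.at_of_ne .rel (.sgn ε) h𝔭𝔭') h𝔭p x,
       map_add' := map_add _, map_smul' := fun f x ↦ hloc'_smul f x }, fun _ ↦ rfl⟩
  -- `ψ = Log ∘ loc_𝔭 : Sel_ε → Λ` and `ψ' = Log ∘ loc_𝔭 : Sel^{ε,rel} → Λ`
  obtain ⟨ψ, hψ⟩ : ∃ ψ : selmerLambdaAdic W p κ γ (fun _ ↦ .sgn ε) →ₗ[IwasawaAlgebra p]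
      IwasawaAlgebra p, ∀ x, ψ x = Log (locSignedAt W p κ 𝔭 h𝔭 γ γ𝔭 hγ𝔭 (fun _ ↦ .sgn ε) ε rfl h𝔭p x) :=
    ⟨Logₗ ∘ₗ locₗ, fun x ↦ by rw [LinearMap.comp_apply, hlocₗ, hLogₗ]⟩
  obtain ⟨ψ', hψ'⟩ : ∃ ψ' : selmerLambdaAdic W p κ γ (PCond.at 𝔭' .rel (.sgn ε)) →ₗ[IwasawaAlgebra p]
      IwasawaAlgebra p, ∀ x, ψ' x = Log (locSignedAt W p κ 𝔭 h𝔭 γ γ𝔭 hγ𝔭 (PCond.at 𝔭' .rel (.sgn ε)) ε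
        (PCond.at_of_ne .rel (.sgn ε) h𝔭𝔭') h𝔭p x) :=
    ⟨Logₗ ∘ₗ loc'ₗ, fun x ↦ by rw [LinearMap.comp_apply, hloc'ₗ, hLogₗ]⟩
  have hψ_inj : Function.Injective ψ := by
    intro x y hxy
    rw [hψ, hψ] at hxy
    exact hinj (hLog.2.1 hxy)
  have ha : ψ z ≠ 0 := by
    intro ha0
    rw [hψ] at ha0
    have h0 : locSignedAt W p κ 𝔭 h𝔭 γ γ𝔭 hγ𝔭 (fun _ ↦ .sgn ε) ε rfl h𝔭p z = 0 :=
      hLog.2.1 (by rw [map_zero]; exact ha0)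
    exact h.ne_zero (hinj (by rw [map_zero]; exact h0))
  have hιa : IwasawaAlgebra.invol p (ψ z) ≠ 0 := fun h0 ↦
    ha (IwasawaAlgebra.invol_injective p (by rw [h0, map_zero]))
  -- the ideals `I = Log(loc(Sel_ε))` and `I' = Log(loc(Sel^{ε,rel}))` COINCIDE (`hEq`)
  have haI : ψ z ∈ LinearMap.range ψ := ⟨z, rfl⟩
  have hII' : LinearMap.range ψ = LinearMap.range ψ' := by
    apply le_antisymm
    · rintro _ ⟨x, rfl⟩
      exact ⟨AddSubgroup.inclusion hle x, by rw [hψ', hψ, hloc'_incl]⟩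
    · rintro _ ⟨x', rfl⟩
      obtain ⟨x, hx⟩ := hEq x'
      exact ⟨x, by rw [hψ, hψ', hx]⟩
  have haI' : ψ z ∈ LinearMap.range ψ' := hII' ▸ haI
  -- (6.14): `char(Sel_ε/Λz) · char(Λ/I) = (a)`, `a = ψ z = Log(loc z)`
  have h614 : Module.charIdeal (IwasawaAlgebra p)
        (selmerLambdaAdic W p κ γ (fun _ ↦ .sgn ε) ⧸ Submodule.span (IwasawaAlgebra p) {z}) *
      Module.charIdeal (IwasawaAlgebra p) (IwasawaAlgebra p ⧸ LinearMap.range ψ) =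
        Ideal.span {ψ z} :=
    charIdeal_quotient_span_mul_charIdeal_quotient_range ψ hψ_inj z ha
  -- the twisted cokernels as quotients of `Λ`
  obtain ⟨δ', hδ'lin, hδ'ker, hδ'im⟩ := h.exact613
  obtain ⟨δ, hδlin, hδker, hδim⟩ := h.exact612
  obtain ⟨Φ', hΦ'im, hΦ'ker⟩ := exists_linearMap_range_eq_ker_eq_of_semilinear
    (fun x ↦ locSignedAt W p κ 𝔭 h𝔭 γ γ𝔭 hγ𝔭 (fun _ ↦ .sgn ε) ε rfl h𝔭p x) Log hLog.1 hLog.2 δ'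
    hδ'lin hδ'ker (LinearMap.range ψ) (fun f ↦ by
      rw [LinearMap.mem_range]
      exact exists_congr fun x ↦ by rw [hψ])
  obtain ⟨Φ, hΦim, hΦker⟩ := exists_linearMap_range_eq_ker_eq_of_semilinear
    (fun x ↦ locSignedAt W p κ 𝔭 h𝔭 γ γ𝔭 hγ𝔭 (PCond.at 𝔭' .rel (.sgn ε)) ε
      (PCond.at_of_ne .rel (.sgn ε) h𝔭𝔭') h𝔭p x) Log hLog.1 hLog.2 δ
    hδlin hδker (LinearMap.range ψ') (fun f ↦ by
      rw [LinearMap.mem_range]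
      exact exists_congr fun x ↦ by rw [hψ'])
  -- the restriction maps `r' : X^{rel,ε} ↠ X_ε`, `r : X^{rel,str} ↠ X^{ε,str}` and their kernels
  obtain ⟨r', hr'_apply, hr'_surj⟩ := X.exists_restrict_linearMap W p κ hγ
    (selmer_sgn_le_at_rel W p κ ∅ 𝔭 ε)
  obtain ⟨r, hr_apply, hr_surj⟩ := X.exists_restrict_linearMap W p κ hγ
    (selmer_at_le_rel_away W p κ ∅ (𝔮 := 𝔭') .str (.sgn ε))
  have hker_r' : LinearMap.ker r' = LinearMap.range Φ' := by
    ext x'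
    rw [LinearMap.mem_ker, hr'_apply, ← hδ'im x', LinearMap.mem_range]
    exact (hΦ'im x').symm
  have hker_r : LinearMap.ker r = LinearMap.range Φ := by
    ext x'
    rw [LinearMap.mem_ker, hr_apply, ← hδim x', LinearMap.mem_range]
    exact (hΦim x').symm
  -- both kernels are killed by `ι(a) ≠ 0`
  have hY'tors : ∀ x ∈ LinearMap.ker r', IwasawaAlgebra.invol p (ψ z) • x = 0 := by
    intro x hx
    rw [hker_r', LinearMap.mem_range] at hx
    obtain ⟨f, rfl⟩ := hx
    have h0 : Φ' (IwasawaAlgebra.invol p (ψ z)) = 0 := by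
      rw [← LinearMap.mem_ker, hΦ'ker]
      exact Ideal.mem_map_of_mem _ haI
    rw [← map_smul, smul_eq_mul, mul_comm, ← smul_eq_mul, map_smul, h0, smul_zero]
  have hYtors : ∀ x ∈ LinearMap.ker r, IwasawaAlgebra.invol p (ψ z) • x = 0 := by
    intro x hx
    rw [hker_r, LinearMap.mem_range] at hx
    obtain ⟨f, rfl⟩ := hx
    have h0 : Φ (IwasawaAlgebra.invol p (ψ z)) = 0 := by
      rw [← LinearMap.mem_ker, hΦker]
      exact Ideal.mem_map_of_mem _ haI'
    rw [← map_smul, smul_eq_mul, mul_comm, ← smul_eq_mul, map_smul, h0, smul_zero]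
  -- the abstract chain (6.15)–(6.16): `char(X^{rel,str}) = char(ker r)·char(ker r')·char(X_{ε,tors})`
  obtain ⟨-, -, -, h616⟩ :=
    Module.isTorsion_and_charIdeal_eq_of_surjective_pair r' hr'_surj r hr_surj
      (IwasawaAlgebra.invol p (ψ z)) hιa hY'tors hYtors hX.2 h.lemma67.1 h.lemma67.2
  -- the kernels: `char(ker r') = ι(char(Λ/I)) = char(ker r)` (`I = I'`)
  have eY' : LinearMap.ker r' ≃ₗ[IwasawaAlgebra p]
      (IwasawaAlgebra p ⧸ Ideal.map (IwasawaAlgebra.invol p) (LinearMap.range ψ)) :=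
    (LinearEquiv.ofEq _ _ hker_r').trans
      (Φ'.quotKerEquivRange.symm.trans (Submodule.quotEquivOfEq _ _ hΦ'ker))
  have eY : LinearMap.ker r ≃ₗ[IwasawaAlgebra p]
      (IwasawaAlgebra p ⧸ Ideal.map (IwasawaAlgebra.invol p) (LinearMap.range ψ)) :=
    (LinearEquiv.ofEq _ _ hker_r).trans
      (Φ.quotKerEquivRange.symm.trans (Submodule.quotEquivOfEq _ _ (hII' ▸ hΦker)))
  have hY'char : Module.charIdeal (IwasawaAlgebra p) (LinearMap.ker r') =
      (Module.charIdeal (IwasawaAlgebra p) (IwasawaAlgebra p ⧸ LinearMap.range ψ)).map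
        (IwasawaAlgebra.invol p) := by
    rw [Module.charIdeal_eq_of_linearEquiv eY', charIdeal_quotient_map_invol]
  have hYchar : Module.charIdeal (IwasawaAlgebra p) (LinearMap.ker r) =
      Module.charIdeal (IwasawaAlgebra p) (LinearMap.ker r') := by
    rw [Module.charIdeal_eq_of_linearEquiv eY', Module.charIdeal_eq_of_linearEquiv eY]
  -- `(ι a)² = ι(char(Sel_ε/Λz))² · char(ker r')²`
  have hιa_span : Ideal.span {IwasawaAlgebra.invol p (ψ z) ^ 2} =
      ((Module.charIdeal (IwasawaAlgebra p)
          (selmerLambdaAdic W p κ γ (fun _ ↦ .sgn ε) ⧸ Submodule.span (IwasawaAlgebra p) {z})).map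
          (IwasawaAlgebra.invol p)) ^ 2 *
        (Module.charIdeal (IwasawaAlgebra p) (LinearMap.ker r')) ^ 2 := by
    rw [hY'char, ← mul_pow, ← map_invol_mul, h614, map_invol_span_singleton, Ideal.span_singleton_pow]
  -- the chain of (in)equalities
  have hmain : Ideal.span {((p : ℕ) : IwasawaAlgebra p) ^ k} *
        Module.charIdeal (IwasawaAlgebra p) (X W p κ ∅ (PCond.at 𝔭' .str .rel)) ≤
      Ideal.span {IwasawaAlgebra.invol p (ψ z) ^ 2} := by
    rw [hιa_span, h616, hYchar]
    calc Ideal.span {((p : ℕ) : IwasawaAlgebra p) ^ k} *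
          (Module.charIdeal (IwasawaAlgebra p) (LinearMap.ker r') *
            (Module.charIdeal (IwasawaAlgebra p) (LinearMap.ker r') *
              Module.charIdeal (IwasawaAlgebra p)
                (Submodule.torsion (IwasawaAlgebra p) (X W p κ ∅ (fun _ ↦ .sgn ε)))))
        = (Module.charIdeal (IwasawaAlgebra p) (LinearMap.ker r')) ^ 2 *
            (Ideal.span {((p : ℕ) : IwasawaAlgebra p) ^ k} *
              X.torsionCharIdeal W p κ ∅ (fun _ ↦ .sgn ε) hγ) := by
          change _ = _ * (_ * Module.charIdeal (IwasawaAlgebra p)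
            (Submodule.torsion (IwasawaAlgebra p) (X W p κ ∅ (fun _ ↦ .sgn ε))))
          ring
      _ ≤ (Module.charIdeal (IwasawaAlgebra p) (LinearMap.ker r')) ^ 2 *
            ((Module.charIdeal (IwasawaAlgebra p)
              (selmerLambdaAdic W p κ γ (fun _ ↦ .sgn ε) ⧸
                Submodule.span (IwasawaAlgebra p) {z})).map (IwasawaAlgebra.invol p)) ^ 2 :=
          Ideal.mul_mono_right hEis
      _ = ((Module.charIdeal (IwasawaAlgebra p)
              (selmerLambdaAdic W p κ γ (fun _ ↦ .sgn ε) ⧸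
                Submodule.span (IwasawaAlgebra p) {z})).map (IwasawaAlgebra.invol p)) ^ 2 *
            (Module.charIdeal (IwasawaAlgebra p) (LinearMap.ker r')) ^ 2 := mul_comm _ _
  have hψz : ψ z = Log (locSignedAt W p κ 𝔭 h𝔭 γ γ𝔭 hγ𝔭 (fun _ ↦ .sgn ε) ε rfl h𝔭p z) := hψ z
  rw [← hψz]
  exact hmain

/-- **Along a structure map: `(p^k)·char_Λ(X^{rel,str})·R₀⟦T⟧ ⊆ (L)`.** From the transfer
(`span_pow_mul_charIdeal_le_span_sq`) and the explicit reciprocity law of the inputs,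
`(L) = ι((Log loc_𝔭 z)²)·R₀⟦T⟧` along every `j : ℤ_p → R₀` compatible with `ℤ_p ⊂ ℂ_p` (field
`signedLog_erl`). Printed target: "(ii) … `char_{Λac}(X^{rel,str}) Λ^ur ⊂ (L_p^BDP)`" with the opposite
inclusion, here up to `p^k`. [cite: CastellaWan2023, Thm. 6.8 (ii) and its proof (MS pp. 30–31), Thm. 6.2 (MS p. 26)] -/
theorem TransferInputs.span_pow_mul_charIdeal_map_le_span [W.IsElliptic]
    (h : TransferInputs W p κ γ hγ 𝔭 h𝔭 γ𝔭 hγ𝔭 𝔭' h𝔭𝔭' h𝔭p ε z L)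
    (hinj : Function.Injective (locSignedAt W p κ 𝔭 h𝔭 γ γ𝔭 hγ𝔭 (fun _ ↦ .sgn ε) ε rfl h𝔭p))
    (hX : X.HasRank W p κ ∅ (fun _ ↦ .sgn ε) hγ 1)
    (hEq : ∀ x' : selmerLambdaAdic W p κ γ (PCond.at 𝔭' .rel (.sgn ε)),
      ∃ x : selmerLambdaAdic W p κ γ (fun _ ↦ .sgn ε),
        locSignedAt W p κ 𝔭 h𝔭 γ γ𝔭 hγ𝔭 (fun _ ↦ .sgn ε) ε rfl h𝔭p x =
          locSignedAt W p κ 𝔭 h𝔭 γ γ𝔭 hγ𝔭 (PCond.at 𝔭' .rel (.sgn ε)) ε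
            (PCond.at_of_ne .rel (.sgn ε) h𝔭𝔭') h𝔭p x')
    {k : ℕ}
    (hEis :
      letI := selmerLambdaAdic.moduleOfGen W p κ γ hγ (fun _ ↦ PCond.sgn ε)
      Ideal.span {((p : ℕ) : IwasawaAlgebra p) ^ k} * X.torsionCharIdeal W p κ ∅ (fun _ ↦ .sgn ε) hγ ≤
        ((Module.charIdeal (IwasawaAlgebra p)
          (selmerLambdaAdic W p κ γ (fun _ ↦ .sgn ε) ⧸
            Submodule.span (IwasawaAlgebra p) {z})).map (IwasawaAlgebra.invol p)) ^ 2)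
    (j : ℤ_[p] →+* unrIntegers p)
    (hj : ∀ x : ℤ_[p], ((j x : unrIntegers p) : ℂ_[p]) = algebraMap ℚ_[p] ℂ_[p] (x : ℚ_[p])) :
    Ideal.span {((p : ℕ) : UnrSeries p) ^ k} *
        (X.charIdeal W p κ ∅ (PCond.at 𝔭' .str .rel) hγ).map (PowerSeries.map j) ≤
      Ideal.span {L} := by
  obtain ⟨Log, hLog, herl⟩ := h.signedLog_erl
  have hsq := TransferInputs.span_pow_mul_charIdeal_le_span_sq h hinj hX hEq hEis Log hLog
  have hmap := Ideal.map_mono (f := PowerSeries.map j) hsq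
  rw [Ideal.map_mul, Ideal.map_span, Set.image_singleton, map_pow, map_natCast] at hmap
  rw [herl j hj, map_pow]
  exact hmap

end Assembly

/-! ## §2 The reading on `Castella2018.AcSelmer.XAc` for a base change `W⁄K` -/

section Corollary

variable {K : Type} [Field K] [NumberField K] {W : WeierstrassCurve ℚ} {p : ℕ} [Fact p.Prime]
  {κ : ZpExtension K p} {γ : absoluteGaloisGroup K} [hγF : Fact (κ.IsTopGenerator γ)]
  {𝔭 : HeightOneSpectrum (𝓞 K)} {h𝔭 : IsNonsplitIn κ 𝔭} {γ𝔭 : absoluteGaloisGroup (𝔭.adicCompletion K)}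
  {hγ𝔭 : κ (resGalOfEmb (closureEmb (K := K) (𝔭.adicCompletion K)) γ𝔭) = κ γ}
  {𝔭' : HeightOneSpectrum (𝓞 K)} {h𝔭𝔭' : 𝔭 ≠ 𝔭'} {h𝔭p : ((p : ℕ) : 𝓞 K) ∈ 𝔭.asIdeal} {ε : ℤˣ}
  {z : selmerLambdaAdic (W.baseChange K) p κ γ (fun _ ↦ .sgn ε)} {L : UnrSeries p}

/-- **The rational Eisenstein half of the BDP statement from the Eisenstein half of the signed
Heegner point statement, in the crux's object `AcSelmer.XAc`** (`W⁄K` a base change, `p ∈ 𝔭'`): the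
hypotheses of §1 (Eisenstein input in the sibling currency `signedHeegnerCharIdeal`) give, along every
compatible `j : ℤ_p → R₀`, `(p^k)·Ch_Λ(X_ac)·R₀⟦T⟧ ⊆ (L)` for `X_ac = AcSelmer.XAc (W⁄K) p κ 𝔭' ∅ γ`.
With the `⊇` corollary `AcSigned.TransferInputs.mem_XAc_charIdeal_map_of_howard` this is the printed
"Conjectures 4.8 and 5.2 are equivalent" in divisibility form, given `hEq`.
[cite: CastellaWan2023, Thm. 6.8 (MS pp. 29–31)] [cite: Castella2018, Def. 2.2 (arXiv:1704.06608 p. 5)] -/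
theorem TransferInputs.span_pow_mul_XAc_charIdeal_map_le_span [W.IsElliptic]
    (h : TransferInputs (W.baseChange K) p κ γ hγF.out 𝔭 h𝔭 γ𝔭 hγ𝔭 𝔭' h𝔭𝔭' h𝔭p ε z L)
    (h𝔭'p : ((p : ℕ) : 𝓞 K) ∈ 𝔭'.asIdeal)
    (hinj : Function.Injective
      (locSignedAt (W.baseChange K) p κ 𝔭 h𝔭 γ γ𝔭 hγ𝔭 (fun _ ↦ .sgn ε) ε rfl h𝔭p))
    (hX : X.HasRank (W.baseChange K) p κ ∅ (fun _ ↦ .sgn ε) hγF.out 1)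
    (hEq : ∀ x' : selmerLambdaAdic (W.baseChange K) p κ γ (PCond.at 𝔭' .rel (.sgn ε)),
      ∃ x : selmerLambdaAdic (W.baseChange K) p κ γ (fun _ ↦ .sgn ε),
        locSignedAt (W.baseChange K) p κ 𝔭 h𝔭 γ γ𝔭 hγ𝔭 (fun _ ↦ .sgn ε) ε rfl h𝔭p x =
          locSignedAt (W.baseChange K) p κ 𝔭 h𝔭 γ γ𝔭 hγ𝔭 (PCond.at 𝔭' .rel (.sgn ε)) ε
            (PCond.at_of_ne .rel (.sgn ε) h𝔭𝔭') h𝔭p x')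
    {k : ℕ}
    (hEis : Ideal.span {((p : ℕ) : IwasawaAlgebra p) ^ k} *
        X.torsionCharIdeal (W.baseChange K) p κ ∅ (fun _ ↦ .sgn ε) hγF.out ≤
      (signedHeegnerCharIdeal hγF.out ε z).map (IwasawaAlgebra.invol p) ^ 2)
    (j : ℤ_[p] →+* unrIntegers p)
    (hj : ∀ x : ℤ_[p], ((j x : unrIntegers p) : ℂ_[p]) = algebraMap ℚ_[p] ℂ_[p] (x : ℚ_[p])) :
    Ideal.span {((p : ℕ) : UnrSeries p) ^ k} *
        (Castella2018.AcSelmer.XAc.charIdeal (W.baseChange K) p κ 𝔭' ∅ γ).map (PowerSeries.map j) ≤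
      Ideal.span {L} := by
  rw [← X.charIdeal_at_str_rel_eq_XAc_charIdeal (W.baseChange K) p κ ∅ γ h𝔭'p]
  exact TransferInputs.span_pow_mul_charIdeal_map_le_span h hinj hX hEq hEis j hj

end Corollary

end Summit.BirchSwinnertonDyer.BirchSwinnertonDyer.Theorems.SignedBaseChangeAcDivEisensteinTransfer

end
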